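import Summits.QuantumFields.BalabanUV.Beta.EriceRemainderEnclosureHistoryAutonomyComparisonIsotoneExcess

/-!
# EriceRemainderEnclosureHistoryAutonomyComparisonAffineMarkov — (E57b) A DOMINATED SINGLE-AGE MEMORY WITH A MARKOV PART COMPARES AT ANY SIZE: `B` isotone
# on ]0,γ] with floor `b > 0`, ANY zeroth moment, DOMINATED by its age-`K` coordinate (`M·u_K ≤ B u`) and `M`-Lipschitz along it at fixed newest entry
# (`B u − B u′ ≤ M·(u_K − u′_K)` for `u′ ≤ u`, `u′_0 = u_0`) — e.g. the two-loop-shaped **`b + c·u_0² + M·u_K`** — and every `B′ ≥ B` with a zeroth moment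
# and an ISOTONE excess: ANY box solutions from one pin satisfy **`h′ ≤ h` at every scale** (`le_of_isotone_excess_dom`, `le_of_isotone_excess_quadratic_affine`)

Cell `pub-balaban`, β-function sub-cell, BINDER row D4 «RemainderConst leaves for Bałaban's split» (`HOME/BINDER-OWNERS.md`; owner lineage `b2b-balaban-beta-an4`;
this file by co-owner #2 lineage `b2b-balaban-beta-d4-p2`, generation 50), β-FLOW TEAM duty (1), FREEZE (0) honoured (def-free; (E49k)'s `family_le_of_orbit` ∕
`level_orbit_ge`, (E49j)'s `effective_le_of_small_pin` ∕ `excess_shift_le`, (E48a)'s `family_mem` ∕ `strictAnti_of_memFlow`, (E39)'s `exists_memFlow_zm`, (E43b)'s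
`memFlow_unique_of_monotone_zm`, (E38a)'s `three_sqrt_three_pos`, node U2's `invSq_eq_of_memFlow` ∕ `drive` ∕ `Sharpness.abs_sub_le_half_cube_mul` BY NAME, nothing
restated).  Abstract form of (E57a) `…ComparisonAffine` (the pure affine memory `b + M·u_K`): the same ACCELERATION mechanism, stated for a CLASS — so that a
Markov part in the newest coupling (the shape of a two-loop term `b₁·g²`) may ride along.

HONEST FRAMING (page 1, verbatim and binding).  *"Discharging BetaPertH makes Bałaban's UV stability UNCONDITIONAL — a real constructive-QFT result; it is
NOT the continuum limit and NOT the Clay problem."*  THIS FILE DISCHARGES NOTHING OF THE KIND.  Elementary real analysis about ABSTRACT functionals on a box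
]0,γ]^ℕ with displayed signs, domination and moduli — hypotheses of a census, not facts; the form of Bałaban's (1.22) limit functional (in particular whether
its memory is dominated by one age) is NOT PRINTED ([I] p. 298; GAPS G-t4-U2-1∕-2) and NOT asserted; `b + c·u_0² + M·u_K` is an ILLUSTRATION of the class, not
a claim about (3.73).  Row D4 class UNCHANGED (critical-path width 0; instance 0∕1; D4 DISCHARGE NO DATE).  HONEST DEPENDENCY: continuum YM on T⁴ ⇐ BetaPertH ∧
nine spine estimates (0/9 proved); BetaPertH ⇐ (D1) ∧ (D4) ∧ CAP+tail; G-an2-4 gates asym, D1 and NE2/3/4.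

THE POINT (census sense (α)).  §1: for an isotone `B` with floor and `B(u) ≥ M·u_K` (`M ≥ 0`), along every box solution from every pin `M·K·h(2K) ≤ 1∕h(K)²`
(`mul_mul_le_invSq_of_dom`) and `1∕h(2K)² ≤ 2∕h(K)²` (`invSq_two_mul_le_of_isotone` — ANY isotone memory: the terms read between scales `K` and `2K` are
termwise below those read before `K`), hence the ACCELERATION LEMMA **`accel_of_dom : M·K·h(K)³ ≤ 2`** at any size.  §2: under comparison from the pin the
memory drop is `B h − B h′ ≤ M·(h_K − h′_K) ≤ (M·K·h_K³∕2)·η ≤ η` (`effective_le_of_family_le_at_dom`, size-free), (E49k)'s induction runs verbatim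
(`effective_le_all_dom`), existence∕uniqueness make it family-free (**`le_of_isotone_excess_dom`**).  §3: `b + c·u_0² + M·u_K` (`c, M ≥ 0`) is in the class with
zeroth moment `M + 2cγ` (**`le_of_isotone_excess_quadratic_affine`**).  Together with (E56b) `threshold_exact` the comparison column now reads: a zeroth moment
alone buys comparison exactly up to `M·γ = 3√3·b`; domination by one affine age buys it at any size, with or without a Markov part.

WHAT IS PROVED ([folklore]; 0 `def`, 0 sorry).  §1 **`mul_mul_le_invSq_of_dom`**, **`invSq_two_mul_le_of_isotone`**, **`accel_of_dom`**.  §2 **`effective_le_of_family_le_at_dom`**,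
`effective_le_all_dom`, **`le_of_isotone_excess_dom`**.  §3 **`le_of_isotone_excess_quadratic_affine`**.
-/
noncomputable section
open Finset Set

namespace Summit.QuantumFields.BalabanUV.Beta.EriceRemainderEnclosureHistoryAutonomyComparisonAffineMarkov

open Literature.MathematicalPhysics.QuantumFieldTheory.Balaban1983to89
open Literature.MathematicalPhysics.QuantumFieldTheory.Balaban1983to89.T4BetaStationary
open Literature.MathematicalPhysics.QuantumFieldTheory.Balaban1983to89.T4BetaFlowWellPosed
open Literature.MathematicalPhysics.QuantumFieldTheory.Balaban1983to89.T4BetaFlowWellPosed.Sharpness (abs_sub_le_half_cube_mul)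
open Summit.QuantumFields.BalabanUV.Beta.EriceRemainderEnclosureHistoryAutonomyThreshold (three_sqrt_three_pos)
open Summit.QuantumFields.BalabanUV.Beta.EriceRemainderEnclosureHistoryAutonomyOrder
open Summit.QuantumFields.BalabanUV.Beta.EriceRemainderEnclosureHistoryAutonomyOrderMarkov
open Summit.QuantumFields.BalabanUV.Beta.EriceRemainderEnclosureHistoryAutonomyComparisonExcess
open Summit.QuantumFields.BalabanUV.Beta.EriceRemainderEnclosureHistoryAutonomyComparisonIsotoneExcess
open Summit.QuantumFields.BalabanUV.Beta.EriceRemainderEnclosureHistoryAutonomyExistence (exists_memFlow_zm)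
open Summit.QuantumFields.BalabanUV.Beta.EriceRemainderEnclosureHistoryAutonomyMonotoneGeneral (memFlow_unique_of_monotone_zm)

variable {B B' : (ℕ → ℝ) → ℝ} {M Mz M' γ b y : ℝ} {K : ℕ} {h h' : ℕ → ℝ} {S S' : ℝ → ℕ → ℝ}

/-! ## §1 The acceleration lemma for a DOMINATED memory: `B(u) ≥ M·u_K`, `B` isotone -/

/-- THE DOMINATING MEMORY TERM DRIVES THE LEVELS: `B` isotone with floor `b > 0` and `B(u) ≥ M·u_K` on the box; `h` a box solution from the pin
`y`.  Then `M·K·h(2K) ≤ 1∕h(K)²`. [folklore] -/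
theorem mul_mul_le_invSq_of_dom (hM : 0 ≤ M) (hb : 0 < b) (hlo : ∀ u, SeqBox γ u → b ≤ B u)
    (hdom : ∀ u, SeqBox γ u → M * u K ≤ B u) (hy : 0 < y) (hh : SeqBox γ h) (hf : MemFlow B y h) :
    M * K * h (2 * K) ≤ 1 / h K ^ 2 := by
  have hanti := (strictAnti_of_memFlow hb hlo hh hf).antitone
  rw [invSq_eq_of_memFlow hf K]
  unfold drive
  have hterm : ∀ l ∈ range K, M * h (2 * K) ≤ B (fun j => h (l + 1 + j)) := by
    intro l hl
    have hl' : l < K := mem_range.mp hl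
    have h1 : M * h (l + 1 + K) ≤ B (fun j => h (l + 1 + j)) := hdom _ (seqBox_shift hh (l + 1))
    have h2 : h (2 * K) ≤ h (l + 1 + K) := hanti (by omega)
    exact (mul_le_mul_of_nonneg_left h2 hM).trans h1
  have hsum := sum_le_sum hterm
  rw [sum_const, card_range, nsmul_eq_mul] at hsum
  have : 0 < 1 / y ^ 2 := by positivity
  linarith

/-- THE LEVELS AT MOST DOUBLE OVER THE NEXT `K` SCALES, for ANY isotone memory: `1∕h(2K)² ≤ 2∕h(K)²`. [folklore] -/
theorem invSq_two_mul_le_of_isotone (hmono : ∀ u v : ℕ → ℝ, SeqBox γ u → SeqBox γ v → (∀ j, u j ≤ v j) → B u ≤ B v)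
    (hb : 0 < b) (hlo : ∀ u, SeqBox γ u → b ≤ B u) (hy : 0 < y) (hh : SeqBox γ h) (hf : MemFlow B y h) :
    1 / h (2 * K) ^ 2 ≤ 2 * (1 / h K ^ 2) := by
  have hanti := (strictAnti_of_memFlow hb hlo hh hf).antitone
  rw [invSq_eq_of_memFlow hf (2 * K), invSq_eq_of_memFlow hf K]
  unfold drive
  rw [two_mul, sum_range_add]
  have hterm : ∀ l ∈ range K, B (fun j => h (K + l + 1 + j)) ≤ B (fun j => h (l + 1 + j)) := fun l _ =>
    hmono _ _ (seqBox_shift hh (K + l + 1)) (seqBox_shift hh (l + 1)) fun j => hanti (by omega)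
  have hsum := sum_le_sum hterm
  have : 0 < 1 / y ^ 2 := by positivity
  linarith

/-- **THE ACCELERATION LEMMA FOR A DOMINATED ISOTONE MEMORY**: `B` isotone, floor `b > 0`, `B(u) ≥ M·u_K` on the box ⟹ `M·K·h(K)³ ≤ 2` along every
box solution from every pin. [folklore] -/
theorem accel_of_dom (hmono : ∀ u v : ℕ → ℝ, SeqBox γ u → SeqBox γ v → (∀ j, u j ≤ v j) → B u ≤ B v)
    (hM : 0 ≤ M) (hb : 0 < b) (hlo : ∀ u, SeqBox γ u → b ≤ B u) (hdom : ∀ u, SeqBox γ u → M * u K ≤ B u)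
    (hy : 0 < y) (hh : SeqBox γ h) (hf : MemFlow B y h) : M * K * h K ^ 3 ≤ 2 := by
  have h1 := mul_mul_le_invSq_of_dom hM hb hlo hdom hy hh hf
  have h2 := invSq_two_mul_le_of_isotone (K := K) hmono hb hlo hy hh hf
  have hK := (hh K).1
  have h2K := (hh (2 * K)).1
  have h3 : h K ≤ 2 * h (2 * K) := by
    have e : h K ^ 2 ≤ 4 * h (2 * K) ^ 2 := by
      rw [div_le_iff₀ (by positivity)] at h2
      have : 2 * (1 / h K ^ 2) * h (2 * K) ^ 2 = 2 * h (2 * K) ^ 2 / h K ^ 2 := by ring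
      rw [this, le_div_iff₀ (by positivity)] at h2
      nlinarith
    nlinarith [sq_nonneg (h K - 2 * h (2 * K)), sq_nonneg (h K + 2 * h (2 * K))]
  have h4 : M * K * h (2 * K) * h K ^ 2 ≤ 1 := by
    have := mul_le_mul_of_nonneg_right h1 (sq_nonneg (h K))
    rwa [one_div_mul_cancel (by positivity)] at this
  calc M * K * h K ^ 3 = (M * K * h K ^ 2) * h K := by ring
    _ ≤ (M * K * h K ^ 2) * (2 * h (2 * K)) := mul_le_mul_of_nonneg_left h3 (by positivity)
    _ = 2 * (M * K * h (2 * K) * h K ^ 2) := by ring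
    _ ≤ 2 * 1 := by linarith
    _ = 2 := by ring


/-! ## §2 The estimate under comparison and the induction — NO size condition -/

/-- **UNDER COMPARISON FROM THE PIN, THE EFFECTIVE β-FUNCTIONS ARE ORDERED AT THE PIN — DOMINATED SINGLE-AGE MEMORY, ANY SIZE.**  `B` isotone with floor
`b > 0`, dominated by and Lipschitz along its age-`K` coordinate at fixed newest entry (`M·u_K ≤ B u`; `B u − B u′ ≤ M·(u_K − u′_K)` for `u′ ≤ u` with
`u′_0 = u_0`), `B ≤ B′` with ISOTONE excess; `h`, `h′` box solutions from one pin with `h′ ≤ h`.  Then `B h ≤ B′ h′`. [folklore] -/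
theorem effective_le_of_family_le_at_dom
    (hmono : ∀ u v : ℕ → ℝ, SeqBox γ u → SeqBox γ v → (∀ j, u j ≤ v j) → B u ≤ B v) (hM : 0 ≤ M) (hb : 0 < b)
    (hlo : ∀ u, SeqBox γ u → b ≤ B u) (hdom : ∀ u, SeqBox γ u → M * u K ≤ B u)
    (hdrop : ∀ u u' : ℕ → ℝ, SeqBox γ u → SeqBox γ u' → (∀ j, u' j ≤ u j) → u' 0 = u 0 → B u - B u' ≤ M * (u K - u' K))
    (hexc : ∀ u, SeqBox γ u → B u ≤ B' u)
    (hDmono : ∀ u v : ℕ → ℝ, SeqBox γ u → SeqBox γ v → (∀ j, u j ≤ v j) → B' u - B u ≤ B' v - B v)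
    (hy : 0 < y) (hh : SeqBox γ h) (hf : MemFlow B y h) (hh' : SeqBox γ h') (hf' : MemFlow B' y h') (hle : ∀ j, h' j ≤ h j) :
    B h ≤ B' h' := by
  have hlo' : ∀ u, SeqBox γ u → b ≤ B' u := fun u hu => (hlo u hu).trans (hexc u hu)
  have hanti' : Antitone h' := (strictAnti_of_memFlow hb hlo' hh' hf').antitone
  set η : ℝ := B' h' - B h' with hη_def
  have hη0 : 0 ≤ η := by rw [hη_def]; linarith [hexc h' hh']
  have hηs : ∀ n, |B (fun j => h' (n + 1 + j)) - B' (fun j => h' (n + 1 + j))| ≤ η := excess_shift_le hexc hDmono hh' hanti'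
  -- levels: 0 ≤ a′_K − a_K ≤ K·η
  have hlev : 1 / h' K ^ 2 - 1 / h K ^ 2 ≤ (K : ℝ) * η := by
    rw [invSq_eq_of_memFlow hf K, invSq_eq_of_memFlow hf' K, show (1:ℝ) / y ^ 2 + drive B' h' K - (1 / y ^ 2 + drive B h K)
      = drive B' h' K - drive B h K by ring]
    unfold drive
    rw [← sum_sub_distrib]
    calc ∑ l ∈ range K, (B' (fun k => h' (l + 1 + k)) - B (fun k => h (l + 1 + k)))
        ≤ ∑ _l ∈ range K, η := sum_le_sum fun l _ => by
          have e1 := (abs_le.mp (hηs l)).1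
          have e2 := hmono _ _ (seqBox_shift hh' (l + 1)) (seqBox_shift hh (l + 1)) fun k => hle (l + 1 + k)
          linarith
      _ = (K : ℝ) * η := by rw [sum_const, card_range, nsmul_eq_mul]
  have hlev0 : 0 ≤ 1 / h' K ^ 2 - 1 / h K ^ 2 :=
    sub_nonneg.mpr (one_div_le_one_div_of_le (pow_pos (hh' K).1 2) (pow_le_pow_left₀ (hh' K).1.le (hle K) 2))
  have hgap : |h K - h' K| ≤ h K ^ 3 / 2 * ((K : ℝ) * η) := by
    have hw := abs_sub_le_half_cube_mul (hh K).1 (hh' K).1 le_rfl (hle K)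
    have habs : |1 / h K ^ 2 - 1 / h' K ^ 2| ≤ (K : ℝ) * η := by
      rw [abs_sub_comm, abs_of_nonneg hlev0]; exact hlev
    exact hw.trans (mul_le_mul_of_nonneg_left habs (by have := (hh K).1; positivity))
  have hacc := accel_of_dom hmono hM hb hlo hdom hy hh hf
  have hpin : h' 0 = h 0 := by rw [hf.1, hf'.1]
  have hd := hdrop h h' hh hh' hle hpin
  have h1 : h K - h' K ≤ h K ^ 3 / 2 * ((K : ℝ) * η) := (le_abs_self _).trans hgap
  have h2 : M * (h K - h' K) ≤ η :=
    calc M * (h K - h' K) ≤ M * (h K ^ 3 / 2 * ((K : ℝ) * η)) := mul_le_mul_of_nonneg_left h1 hM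
      _ = (M * K * h K ^ 3) / 2 * η := by ring
      _ ≤ 2 / 2 * η := mul_le_mul_of_nonneg_right (div_le_div_of_nonneg_right hacc zero_le_two) hη0
      _ = η := by ring
  rw [hη_def] at h2
  linarith

/-- **THE EFFECTIVE β-FUNCTIONS ARE ORDERED AT EVERY PIN — DOMINATED SINGLE-AGE MEMORY, ANY SIZE** ((E49k)'s induction with §2's size-free step).
[folklore] -/
theorem effective_le_all_dom {b' : ℝ}
    (hmono : ∀ u v : ℕ → ℝ, SeqBox γ u → SeqBox γ v → (∀ j, u j ≤ v j) → B u ≤ B v)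
    (hB : ∀ u u' : ℕ → ℝ, SeqBox γ u → SeqBox γ u' → ∀ D : ℝ, (∀ j, |u j - u' j| ≤ D) → |B u - B u'| ≤ Mz * D)
    (hMz : 0 ≤ Mz) (hM : 0 ≤ M) (hγ : 0 < γ) (hb : 0 < b) (hlo : ∀ u, SeqBox γ u → b ≤ B u)
    (hdom : ∀ u, SeqBox γ u → M * u K ≤ B u)
    (hdrop : ∀ u u' : ℕ → ℝ, SeqBox γ u → SeqBox γ u' → (∀ j, u' j ≤ u j) → u' 0 = u 0 → B u - B u' ≤ M * (u K - u' K))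
    (hexc : ∀ u, SeqBox γ u → B u ≤ B' u)
    (hDmono : ∀ u v : ℕ → ℝ, SeqBox γ u → SeqBox γ v → (∀ j, u j ≤ v j) → B' u - B u ≤ B' v - B v)
    (hb' : 0 < b') (hB' : ∀ u u' : ℕ → ℝ, SeqBox γ u → SeqBox γ u' → ∀ D : ℝ, (∀ j, |u j - u' j| ≤ D) → |B' u - B' u'| ≤ M' * D)
    (hM' : 0 ≤ M') (hlo' : ∀ u, SeqBox γ u → b' ≤ B' u)
    (hS : ∀ p, 0 < p → p ≤ γ → SeqBox γ (S p) ∧ MemFlow B p (S p))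
    (huniq : ∀ p, 0 < p → p ≤ γ → ∀ u u' : ℕ → ℝ, SeqBox γ u → SeqBox γ u' → MemFlow B p u → MemFlow B p u' → u = u')
    (hS' : ∀ p, 0 < p → p ≤ γ → SeqBox γ (S' p) ∧ MemFlow B' p (S' p))
    (huniq' : ∀ p, 0 < p → p ≤ γ → ∀ u u' : ℕ → ℝ, SeqBox γ u → SeqBox γ u' → MemFlow B' p u → MemFlow B' p u' → u = u') :
    ∀ y, 0 < y → y ≤ γ → B (S y) ≤ B' (S' y) := by
  have h33 : 0 < 3 * Real.sqrt 3 := three_sqrt_three_pos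
  have hsq3 : Real.sqrt 3 ^ 2 = 3 := Real.sq_sqrt (by norm_num)
  set L : ℝ := 4 * Mz ^ 2 / (27 * b ^ 2) with hL_def
  have hbase : ∀ y, 0 < y → y ≤ γ → L ≤ 1 / y ^ 2 → B (S y) ≤ B' (S' y) := by
    intro y hy hyγ hlev
    have hMy : Mz * y ≤ 3 * Real.sqrt 3 / 2 * b := by
      have hy2 : 0 < y ^ 2 := by positivity
      have k1 : 4 * Mz ^ 2 ≤ 1 / y ^ 2 * (27 * b ^ 2) := (div_le_iff₀ (by positivity : (0:ℝ) < 27 * b ^ 2)).mp hlev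
      have k2 := mul_le_mul_of_nonneg_right k1 hy2.le
      have e : 1 / y ^ 2 * (27 * b ^ 2) * y ^ 2 = 27 * b ^ 2 := by field_simp
      rw [e] at k2
      have h1 : (2 * Mz * y) ^ 2 ≤ (3 * Real.sqrt 3 * b) ^ 2 := by nlinarith [hsq3, k2]
      have h2 : 2 * Mz * y ≤ 3 * Real.sqrt 3 * b := (sq_le_sq₀ (by positivity) (by positivity)).mp h1
      linarith
    exact effective_le_of_small_pin hB hMz hb hlo hexc hDmono hy hyγ hMy (hS y hy hyγ).1 (hS y hy hyγ).2 (hS' y hy hyγ).1 (hS' y hy hyγ).2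
  have hind : ∀ n : ℕ, ∀ y, 0 < y → y ≤ γ → L - (n : ℝ) * b ≤ 1 / y ^ 2 → B (S y) ≤ B' (S' y) := by
    intro n
    induction n with
    | zero => intro y hy hyγ hlev; exact hbase y hy hyγ (by simpa using hlev)
    | succ n ih =>
      intro y hy hyγ hlev
      have hy' : y ∈ Ioc (0 : ℝ) γ := ⟨hy, hyγ⟩
      have hQ : ∀ j, 1 ≤ j → B (S (S y j)) ≤ B' (S' (S y j)) := by
        intro j hj
        have hm := family_mem hS hy hyγ j
        refine ih (S y j) hm.1 hm.2 ?_
        have := level_orbit_ge hb hlo hS hy' hj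
        rw [Nat.cast_succ] at hlev
        linarith
      have hcomp := family_le_of_orbit hb' hγ hB' hM' hlo' hS huniq hS' huniq' hy' hQ
      exact effective_le_of_family_le_at_dom hmono hM hb hlo hdom hdrop hexc hDmono hy (hS y hy hyγ).1 (hS y hy hyγ).2
        (hS' y hy hyγ).1 (hS' y hy hyγ).2 hcomp
  intro y hy hyγ
  obtain ⟨n, hn⟩ : ∃ n : ℕ, L / b ≤ n := exists_nat_ge (L / b)
  refine hind n y hy hyγ ?_
  have : L ≤ (n : ℝ) * b := by rw [div_le_iff₀ hb] at hn; linarith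
  have : 0 ≤ 1 / y ^ 2 := by positivity
  linarith

/-- **A DOMINATED SINGLE-AGE ISOTONE MEMORY COMPARES UNDER EVERY ISOTONE EXCESS, AT ANY SIZE** (family-free).  `B` on ]0,γ]: isotone, zeroth moment
`M_z ≥ 0` (any size), floor `b > 0`, DOMINATED by its age-`K` coordinate (`M·u_K ≤ B u`, `M ≥ 0`) and Lipschitz along it at fixed newest entry
(`B u − B u′ ≤ M·(u_K − u′_K)` for box `u′ ≤ u` with `u′_0 = u_0`) — e.g. `b + c·u_0² + M·u_K` (§3); `B′` with a zeroth moment, `B ≤ B′`, ISOTONE excess;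
`h`, `h′` ANY box solutions from one pin.  Then `h′ ≤ h` at every scale — NO condition on `M_z·γ∕b`. [folklore] -/
theorem le_of_isotone_excess_dom {p : ℝ}
    (hmono : ∀ u v : ℕ → ℝ, SeqBox γ u → SeqBox γ v → (∀ j, u j ≤ v j) → B u ≤ B v)
    (hB : ∀ u u' : ℕ → ℝ, SeqBox γ u → SeqBox γ u' → ∀ D : ℝ, (∀ j, |u j - u' j| ≤ D) → |B u - B u'| ≤ Mz * D)
    (hMz : 0 ≤ Mz) (hM : 0 ≤ M) (hb : 0 < b) (hlo : ∀ u, SeqBox γ u → b ≤ B u) (hdom : ∀ u, SeqBox γ u → M * u K ≤ B u)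
    (hdrop : ∀ u u' : ℕ → ℝ, SeqBox γ u → SeqBox γ u' → (∀ j, u' j ≤ u j) → u' 0 = u 0 → B u - B u' ≤ M * (u K - u' K))
    (hB' : ∀ u u' : ℕ → ℝ, SeqBox γ u → SeqBox γ u' → ∀ D : ℝ, (∀ j, |u j - u' j| ≤ D) → |B' u - B' u'| ≤ M' * D) (hM' : 0 ≤ M')
    (hexc : ∀ u, SeqBox γ u → B u ≤ B' u)
    (hDmono : ∀ u v : ℕ → ℝ, SeqBox γ u → SeqBox γ v → (∀ j, u j ≤ v j) → B' u - B u ≤ B' v - B v)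
    (hp : 0 < p) (hpγ : p ≤ γ) (hh : SeqBox γ h) (hf : MemFlow B p h) (hh' : SeqBox γ h') (hf' : MemFlow B' p h') (j : ℕ) :
    h' j ≤ h j := by
  have hγ : 0 < γ := hp.trans_le hpγ
  have hlo' : ∀ u, SeqBox γ u → b ≤ B' u := fun u hu => (hlo u hu).trans (hexc u hu)
  have hmono' : ∀ u v : ℕ → ℝ, SeqBox γ u → SeqBox γ v → (∀ j, u j ≤ v j) → B' u ≤ B' v := fun u v hu hv huv => by
    linarith [hDmono u v hu hv huv, hmono u v hu hv huv]
  have hex : ∀ q : ℝ, 0 < q → q ≤ γ → ∃ k : ℕ → ℝ, SeqBox γ k ∧ MemFlow B q k := fun q hq hqγ => exists_memFlow_zm hB hMz hq hqγ hb hlo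
  have hex' : ∀ q : ℝ, 0 < q → q ≤ γ → ∃ k : ℕ → ℝ, SeqBox γ k ∧ MemFlow B' q k := fun q hq hqγ => exists_memFlow_zm hB' hM' hq hqγ hb hlo'
  choose! S hSb hSf using hex
  choose! S' hS'b hS'f using hex'
  have hS : ∀ q, 0 < q → q ≤ γ → SeqBox γ (S q) ∧ MemFlow B q (S q) := fun q hq hqγ => ⟨hSb q hq hqγ, hSf q hq hqγ⟩
  have hS' : ∀ q, 0 < q → q ≤ γ → SeqBox γ (S' q) ∧ MemFlow B' q (S' q) := fun q hq hqγ => ⟨hS'b q hq hqγ, hS'f q hq hqγ⟩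
  have huniq : ∀ q, 0 < q → q ≤ γ → ∀ u u' : ℕ → ℝ, SeqBox γ u → SeqBox γ u' → MemFlow B q u → MemFlow B q u' → u = u' :=
    fun q hq _ u u' hu hu' hfu hfu' => memFlow_unique_of_monotone_zm hmono hB hMz hq hb hlo hu hu' hfu hfu'
  have huniq' : ∀ q, 0 < q → q ≤ γ → ∀ u u' : ℕ → ℝ, SeqBox γ u → SeqBox γ u' → MemFlow B' q u → MemFlow B' q u' → u = u' :=
    fun q hq _ u u' hu hu' hfu hfu' => memFlow_unique_of_monotone_zm hmono' hB' hM' hq hb hlo' hu hu' hfu hfu'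
  have e : h = S p := huniq p hp hpγ _ _ hh (hS p hp hpγ).1 hf (hS p hp hpγ).2
  have e' : h' = S' p := huniq' p hp hpγ _ _ hh' (hS' p hp hpγ).1 hf' (hS' p hp hpγ).2
  rw [e, e']
  exact family_le_of_orbit hb hγ hB' hM' hlo' hS huniq hS' huniq' ⟨hp, hpγ⟩ (fun i _ =>
    effective_le_all_dom hmono hB hMz hM hγ hb hlo hdom hdrop hexc hDmono hb hB' hM' hlo' hS huniq hS' huniq' _
      (family_mem hS hp hpγ i).1 (family_mem hS hp hpγ i).2) j

/-! ## §3 The two-loop-shaped example: `B(u) = b + c·u_0² + M·u_K` — a Markov quadratic part in the newest coupling plus ONE affine memory term -/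

/-- **`b + c·u_0² + M·u_K` COMPARES UNDER EVERY ISOTONE EXCESS, AT ANY SIZE** (`b > 0`, `c ≥ 0`, `M ≥ 0` of any size, any age `K`): on ]0,γ] it is isotone,
has zeroth moment `M + 2cγ`, floor `b`, is dominated by `M·u_K` and `M`-Lipschitz along `u_K` at fixed `u_0`; so `le_of_isotone_excess_dom` applies: for
every `B′ ≥ B` with a zeroth moment and an isotone excess, ANY box solutions from one pin satisfy `h′ ≤ h` at every scale. [folklore] -/
theorem le_of_isotone_excess_quadratic_affine {c p : ℝ} (hc : 0 ≤ c) (hM : 0 ≤ M) (hb : 0 < b) (hγ : 0 < γ)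
    (hB' : ∀ u u' : ℕ → ℝ, SeqBox γ u → SeqBox γ u' → ∀ D : ℝ, (∀ j, |u j - u' j| ≤ D) → |B' u - B' u'| ≤ M' * D) (hM' : 0 ≤ M')
    (hexc : ∀ u, SeqBox γ u → (fun w : ℕ → ℝ => b + c * w 0 ^ 2 + M * w K) u ≤ B' u)
    (hDmono : ∀ u v : ℕ → ℝ, SeqBox γ u → SeqBox γ v → (∀ j, u j ≤ v j) →
      B' u - (fun w : ℕ → ℝ => b + c * w 0 ^ 2 + M * w K) u ≤ B' v - (fun w : ℕ → ℝ => b + c * w 0 ^ 2 + M * w K) v)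
    (hp : 0 < p) (hpγ : p ≤ γ) (hh : SeqBox γ h) (hf : MemFlow (fun w : ℕ → ℝ => b + c * w 0 ^ 2 + M * w K) p h)
    (hh' : SeqBox γ h') (hf' : MemFlow B' p h') (j : ℕ) : h' j ≤ h j := by
  refine le_of_isotone_excess_dom (B := fun w : ℕ → ℝ => b + c * w 0 ^ 2 + M * w K) (Mz := M + 2 * c * γ) (M := M) (K := K)
    ?_ ?_ (by positivity) hM hb ?_ ?_ ?_ hB' hM' hexc hDmono hp hpγ hh hf hh' hf' j
  · intro u v hu _ huv
    have h0 := huv 0; have hk := huv K; have := (hu 0).1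
    nlinarith [mul_le_mul h0 h0 this.le ((hu 0).1.le.trans h0)]
  · intro u u' hu hu' D hD
    have e : b + c * u 0 ^ 2 + M * u K - (b + c * u' 0 ^ 2 + M * u' K) = c * ((u 0 + u' 0) * (u 0 - u' 0)) + M * (u K - u' K) := by ring
    rw [e]
    have hsum : |u 0 + u' 0| ≤ 2 * γ := by
      rw [abs_of_pos (by linarith [(hu 0).1, (hu' 0).1])]; linarith [(hu 0).2, (hu' 0).2]
    calc |c * ((u 0 + u' 0) * (u 0 - u' 0)) + M * (u K - u' K)|
        ≤ |c * ((u 0 + u' 0) * (u 0 - u' 0))| + |M * (u K - u' K)| := abs_add_le _ _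
      _ = c * (|u 0 + u' 0| * |u 0 - u' 0|) + M * |u K - u' K| := by
          rw [abs_mul, abs_mul, abs_mul, abs_of_nonneg hc, abs_of_nonneg hM]
      _ ≤ c * (2 * γ * D) + M * D := add_le_add (mul_le_mul_of_nonneg_left
          (mul_le_mul hsum (hD 0) (abs_nonneg _) (by positivity)) hc) (mul_le_mul_of_nonneg_left (hD K) hM)
      _ = (M + 2 * c * γ) * D := by ring
  · intro u hu; nlinarith [(hu K).1, sq_nonneg (u 0)]
  · intro u hu; nlinarith [sq_nonneg (u 0), hb]
  · intro u u' hu hu' _ h0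
    rw [h0]
    linarith

end Summit.QuantumFields.BalabanUV.Beta.EriceRemainderEnclosureHistoryAutonomyComparisonAffineMarkov
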